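import Summits.CriticalPhenomena.CardyFormulaZ2.Theorems.CardyIKTransportIKLinearTransportScreeningAssemblyDefs
import Summits.CriticalPhenomena.CardyFormulaZ2.Theorems.CardyIKTransportIKLinearTransportScreeningArray

/-!
# `stub_Screening` (crux stmt-CriticalPhenomena-5076, line `pinned-diagram-exchange`) — GEOMETRY sub-goals
# of the assembly

Support file (`--supports stmt-CriticalPhenomena-5076`) proving the registered geometry sub-goals
`obsShear_agree_far`, `obsShear_agree_box`, `farObs_projEnv`, `boxObs_projEnv`, `boxObs_offset` of the lead's
assembly of `stub_Screening`, on top of the landed vocabulary (`…ScreeningAssemblyDefs.lean`: `Qarr`, `Cbox`,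
`intCells`, `boxCells`, `projEnv`, `farIn`, `farObs`, `boxObs`), the landed gauge identities
(`…ScreeningGauge.lean`: `mem_blackSet_screenShear`, `inPar_span_far_top/right/bottom/left`,
`outPar_rect0_near`) and the array vocabulary (`…ScreeningArray.lean`: `colPar`, `rowPar`, `parities`,
`tailPar`, `boxData`).

SETTING (fixed `S a b w h n`): near region `[x₁, x₂) × [y₁, y₂)`, `x₁ = a - n`, `x₂ = a + w + n`, `y₁ = b - n`,
`y₂ = b + h + n`; internal plaquette array `m × k`, `m = w + 2n - 1 = x₂ - 1 - x₁`, `k = h + 2n - 1 = y₂ - 1 - y₁`,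
entry `(c, r)` = plaquette bit of the face `(x₁ + c, y₁ + r)`. The proofs are bookkeeping: reindexing
`Fin m × Fin k ≃ intF` by `f ↦ (x₁ + f.1, y₁ + f.2)`, uniqueness of the box index of a box cell, the fact that
`projEnv` changes plaquettes only on internal faces (which `outPar` never reads) and coins only on the box, and
exclusive-or algebra for the additive offset (`outPar_rect0_near` applied to both environments).
-/

noncomputable section

namespace Summit.CriticalPhenomena.CardyFormulaZ2.Theorems.IKLinearTransport.PinnedDiagramExchange.ScreeningAssembly

open scoped Classical symmDiff BigOperators
open MeasureTheory ProbabilityTheory Set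
open Literature.Probability.Percolation Literature.Probability.LatticeModels
open ScreeningGauge ScreeningArray

/-! ## §A Bookkeeping helpers -/

/-- Cancellation helper for exclusive or. [folklore] -/
theorem xor_cancel_left' (A B : Prop) : Xor A (Xor A B) ↔ B := by grind

/-- The exclusive-or bookkeeping of the additive offset (11 atoms, linear over `𝔽₂`; normalised with the landed
`IKQuarterTurn.xor_left_comm'`). [folklore] -/
theorem xor_offset_aux (c c' r r' C C' F F' G G' T : Prop) :
    Xor c' (Xor r' (Xor (Xor C' (Xor F' G')) T)) ↔
      Xor c (Xor r (Xor (Xor C (Xor F G)) (Xor T (Xor (Xor (Xor c c') (Xor (Xor F F') (Xor C C')))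
        (Xor (Xor r r') (Xor G G')))))) := by
  simp only [IKQuarterTurn.xor_left_comm', xor_comm, xor_cancel_left']

/-- Boolean exclusive or of a bit and two decided propositions. [folklore] -/
theorem xor_decide_decide_iff (t : Bool) (P Q : Prop) [Decidable P] [Decidable Q] :
    xor t (xor (decide P) (decide Q)) = true ↔ Xor (t = true) (Xor P Q) := by
  cases t <;> by_cases hP : P <;> by_cases hQ : Q <;> simp [hP, hQ]

/-- Reindexing `Fin k` by the integer interval `[z, z + k)`: filtered cardinalities agree. [folklore] -/
theorem card_filter_fin_eq_card_filter_Ico {k : ℕ} (z : ℤ) (g : Fin k → Prop) [DecidablePred g]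
    (P : ℤ → Prop) [DecidablePred P] (hg : ∀ r : Fin k, g r ↔ P (z + (r : ℤ))) :
    (Finset.univ.filter g).card = ((Finset.Ico z (z + k)).filter P).card := by
  refine Finset.card_bij (fun r _ => z + (r : ℤ)) (fun r hr => ?_) (fun r₁ _ r₂ _ h => Fin.ext (by omega))
    (fun c hc => ?_)
  · simp only [Finset.mem_filter, Finset.mem_univ, true_and, Finset.mem_Ico] at hr ⊢
    have := r.isLt
    exact ⟨⟨by omega, by omega⟩, (hg r).1 hr⟩
  · simp only [Finset.mem_filter, Finset.mem_Ico] at hc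
    refine ⟨⟨(c - z).toNat, by omega⟩, ?_, by simp only; omega⟩
    simp only [Finset.mem_filter, Finset.mem_univ, true_and, hg]
    have : z + (((c - z).toNat : ℕ) : ℤ) = c := by omega
    rw [this]
    exact hc.2

/-- A column parity of the internal array is the parity of the corresponding internal face column. [folklore] -/
theorem colPar_Qarr_iff (S : Set ℤ) (x₁ y₁ y₂ : ℤ) (m k : ℕ) (ω : Ω) (i : Fin m) (hk : y₁ + k = y₂ - 1) :
    colPar (Qarr S x₁ y₁ m k ω) i = true ↔ colParity S y₁ y₂ ω (x₁ + (i : ℤ)) := by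
  rw [colPar, decide_eq_true_iff, colParity, ← hk]
  exact iff_of_eq (congrArg Odd (card_filter_fin_eq_card_filter_Ico y₁ _ _ fun r => by simp [Qarr]))

/-- A row parity of the internal array is the parity of the corresponding internal face row. [folklore] -/
theorem rowPar_Qarr_iff (S : Set ℤ) (x₁ x₂ y₁ : ℤ) (m k : ℕ) (ω : Ω) (j : Fin k) (hm : x₁ + m = x₂ - 1) :
    rowPar (Qarr S x₁ y₁ m k ω) j = true ↔ rowParity S x₁ x₂ ω (y₁ + (j : ℤ)) := by
  rw [rowPar, decide_eq_true_iff, rowParity, ← hm]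
  exact iff_of_eq (congrArg Odd (card_filter_fin_eq_card_filter_Ico x₁ _ _ fun c => by simp [Qarr]))

/-- Uniqueness of the index: `∃ i : Fin m, z + i = c ∧ P i` is `P i₀` once `z + i₀ = c`. [folklore] -/
theorem exists_fin_add_eq_iff {m : ℕ} (z c : ℤ) (P : Fin m → Prop) (i₀ : Fin m) (h₀ : z + (i₀ : ℤ) = c) :
    (∃ i : Fin m, z + (i : ℤ) = c ∧ P i) ↔ P i₀ := by
  refine ⟨fun ⟨i, hi, hP⟩ => ?_, fun hP => ⟨i₀, h₀, hP⟩⟩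
  have : i = i₀ := Fin.ext (by omega)
  exact this ▸ hP

/-- An integer of `[z, z + m)` is `z + i₀` for some `i₀ : Fin m`. [folklore] -/
theorem exists_fin_add_eq {m : ℕ} (z c : ℤ) (h₁ : z ≤ c) (h₂ : c < z + m) : ∃ i₀ : Fin m, z + (i₀ : ℤ) = c :=
  ⟨⟨(c - z).toNat, by omega⟩, by simp only; omega⟩

/-- A box cell has a box index. [folklore] -/
theorem exists_boxIndex (a b : ℤ) (w h : ℕ) (v : Site 2) (hv : v ∈ boxCells a b w h) :
    ∃ ij : Fin w × Fin h, v = ![a + ((ij.1 : ℕ) : ℤ), b + ((ij.2 : ℕ) : ℤ)] := by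
  simp only [boxCells, Set.mem_setOf_eq] at hv
  refine ⟨(⟨(v 0 - a).toNat, by omega⟩, ⟨(v 1 - b).toNat, by omega⟩), ?_⟩
  ext i
  fin_cases i
  · simp only [Fin.zero_eta, Fin.isValue, Matrix.cons_val_zero]; omega
  · simp only [Fin.mk_one, Fin.isValue, Matrix.cons_val_one, Matrix.cons_val_fin_one]; omega

/-- Uniqueness of the box index: `∃ ij, v = cell ij ∧ P ij` is `P ij₀` once `v = cell ij₀`. [folklore] -/
theorem exists_boxIndex_iff (a b : ℤ) (w h : ℕ) (v : Site 2) (ij₀ : Fin w × Fin h)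
    (hv : v = ![a + ((ij₀.1 : ℕ) : ℤ), b + ((ij₀.2 : ℕ) : ℤ)]) (P : Fin w × Fin h → Prop) :
    (∃ ij : Fin w × Fin h, v = ![a + ((ij.1 : ℕ) : ℤ), b + ((ij.2 : ℕ) : ℤ)] ∧ P ij) ↔ P ij₀ := by
  refine ⟨fun ⟨ij, hij, hP⟩ => ?_, fun hP => ⟨ij₀, hv, hP⟩⟩
  have h0 := congrFun (hv.symm.trans hij) 0
  have h1 := congrFun (hv.symm.trans hij) 1
  simp only [Matrix.cons_val_zero, Matrix.cons_val_one, Matrix.cons_val_fin_one, add_right_inj, Nat.cast_inj] at h0 h1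
  have : ij = ij₀ := Prod.ext (Fin.ext h0.symm) (Fin.ext h1.symm)
  exact this ▸ hP

/-- `projEnv` does not change the plaquette bits off the internal faces. [folklore] -/
theorem plaq_projEnv (S : Set ℤ) (a b : ℤ) (w h n : ℕ) (ω : Ω) (f : ℤ × ℤ)
    (hf : f ∉ intF (a - n) (a + w + n) (b - n) (b + h + n)) :
    plaq S (projEnv a b w h n ω) f ↔ plaq S ω f := by
  have hc : (![f.1, f.2] : Site 2) ∉ intCells (a - n) (a + w + n) (b - n) (b + h + n) := by
    simp only [intF, Finset.mem_product, Finset.mem_Ico] at hf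
    simp only [intCells, Set.mem_setOf_eq, Matrix.cons_val_zero, Matrix.cons_val_one, Matrix.cons_val_fin_one]
    omega
  simp only [plaq, parSet, projEnv, Set.mem_setOf_eq, Set.mem_inter_iff, Set.mem_compl_iff, hc,
    not_false_eq_true, and_true]

/-- `projEnv` does not change any external parity. [folklore] -/
theorem outPar_projEnv (S : Set ℤ) (a b : ℤ) (w h n : ℕ) (ω : Ω) (R : Finset (ℤ × ℤ)) :
    outPar S (a - n) (a + w + n) (b - n) (b + h + n) (projEnv a b w h n ω) R ↔
      outPar S (a - n) (a + w + n) (b - n) (b + h + n) ω R := by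
  unfold outPar
  rw [Finset.filter_congr fun f hf => plaq_projEnv S a b w h n ω f (Finset.mem_sdiff.1 hf).2]

/-! ## §B The registered geometry sub-goals -/

/-- REGISTERED SUB-GOAL · FAR AGREEMENT: on far cells the sheared observables are `farObs` of
(ω, parities of `Qarr`). [folklore] -/
theorem obsShear_agree_far :
    ∀ (S : Set ℤ) (a b : ℤ) (w h n m k : ℕ) (ω : Ω) (v : Site 2), (m : ℤ) = w + 2 * n - 1 → (k : ℤ) = h + 2 * n - 1 →
      v ∈ farFrom a b w h n →
      ((v ∈ (obs S (screenShear S (a - n) (a + w + n) (b - n) (b + h + n) ω)).1 ↔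
        v ∈ (farObs S (a - n) (a + w + n) (b - n) (b + h + n) m k ω
          (parities (Qarr S (a - n) (b - n) m k ω))).1) ∧
       (v ∈ (obs S (screenShear S (a - n) (a + w + n) (b - n) (b + h + n) ω)).2 ↔
        v ∈ (farObs S (a - n) (a + w + n) (b - n) (b + h + n) m k ω
          (parities (Qarr S (a - n) (b - n) m k ω))).2)) := by
  intro S a b w h n m k ω v hm hk hv
  refine ⟨?_, Iff.rfl⟩
  have key : inPar S (a - n) (a + w + n) (b - n) (b + h + n) ω (spanRect (v 0) (v 1) (a + w + n) (b + h + n)) ↔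
      farIn (a - n) (a + w + n) (b - n) (b + h + n) m k (parities (Qarr S (a - n) (b - n) m k ω)) v := by
    simp only [farIn, parities]
    simp only [farFrom, Set.mem_setOf_eq] at hv
    rcases lt_or_ge (v 1) (b - n) with hy | hy
    · -- below the near region: a parity of full internal column parities
      rw [inPar_span_far_bottom S _ _ _ _ ω v hy]
      simp only [hy, true_and, not_le.2 hy, false_and, or_false]
      refine iff_of_eq (congrArg Odd (congrArg Finset.card (Finset.filter_congr fun c hc => ?_)))
      simp only [Finset.mem_inter, Finset.mem_Ico] at hc
      obtain ⟨i₀, hi₀⟩ := exists_fin_add_eq (m := m) (a - n) c hc.2.1 (by omega)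
      rw [exists_fin_add_eq_iff (a - n) c _ i₀ hi₀,
        colPar_Qarr_iff S (a - n) (b - n) (b + h + n) m k ω i₀ (by omega), hi₀]
    · rcases le_or_gt (b + h + n) (v 1) with hy' | hy'
      · -- above the near region: nothing internal is seen
        refine iff_of_false (inPar_span_far_top S _ _ _ _ ω v hy') ?_
        rintro (⟨h', -⟩ | ⟨-, -, hodd⟩)
        · omega
        · rw [Finset.Ico_eq_empty (by omega), Finset.filter_empty, Finset.card_empty] at hodd
          exact Nat.not_odd_zero hodd
      · rcases (show v 0 < a - n ∨ a + w + n ≤ v 0 by omega) with hx | hx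
        · -- left of the near region, in its row range: a parity of full internal row parities
          rw [inPar_span_far_left S _ _ _ _ ω v hx hy]
          simp only [hy, hx, true_and, not_lt.2 hy, false_and, false_or]
          refine iff_of_eq (congrArg Odd (congrArg Finset.card (Finset.filter_congr fun r hr => ?_)))
          simp only [Finset.mem_Ico] at hr
          obtain ⟨j₀, hj₀⟩ := exists_fin_add_eq (m := k) (b - n) r (by omega) (by omega)
          rw [exists_fin_add_eq_iff (b - n) r _ j₀ hj₀,
            rowPar_Qarr_iff S (a - n) (a + w + n) (b - n) m k ω j₀ (by omega), hj₀]
        · -- right of the near region: nothing internal is seen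
          refine iff_of_false (inPar_span_far_right S _ _ _ _ ω v hx) ?_
          rintro (⟨h', -⟩ | ⟨-, h', -⟩) <;> omega
  simp only [obs, farObs, Set.mem_setOf_eq, mem_blackSet_screenShear, key]

/-- REGISTERED SUB-GOAL · BOX AGREEMENT: on box cells the sheared observables are `boxObs` of
(ω, box data of `Qarr`, coins). [folklore] -/
theorem obsShear_agree_box :
    ∀ (S : Set ℤ) (a b : ℤ) (w h n m k : ℕ) (ω : Ω) (v : Site 2), (m : ℤ) = w + 2 * n - 1 → (k : ℤ) = h + 2 * n - 1 →
      v ∈ boxCells a b w h →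
      ((v ∈ (obs S (screenShear S (a - n) (a + w + n) (b - n) (b + h + n) ω)).1 ↔
        v ∈ (boxObs S (a - n) (a + w + n) (b - n) (b + h + n) a b w h ω
          (boxData n w h (Qarr S (a - n) (b - n) m k ω)) (Cbox a b w h ω)).1) ∧
       (v ∈ (obs S (screenShear S (a - n) (a + w + n) (b - n) (b + h + n) ω)).2 ↔
        v ∈ (boxObs S (a - n) (a + w + n) (b - n) (b + h + n) a b w h ω
          (boxData n w h (Qarr S (a - n) (b - n) m k ω)) (Cbox a b w h ω)).2)) := by
  intro S a b w h n m k ω v hm hk hv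
  obtain ⟨ij, hij⟩ := exists_boxIndex a b w h v hv
  have h0 : v 0 = a + ((ij.1 : ℕ) : ℤ) := by rw [hij]; simp
  have h1 : v 1 = b + ((ij.2 : ℕ) : ℤ) := by rw [hij]; simp
  have hi := ij.1.isLt
  have hj := ij.2.isLt
  constructor
  · -- colours: the internal spanned rectangle is the tail of the array anchored at `(n + i, n + j)`
    have key : inPar S (a - n) (a + w + n) (b - n) (b + h + n) ω (spanRect (v 0) (v 1) (a + w + n) (b + h + n)) ↔
        boxData n w h (Qarr S (a - n) (b - n) m k ω) ij = true := by
      rw [boxData, tailPar, decide_eq_true_iff, inPar]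
      refine iff_of_eq (congrArg Odd (Eq.symm ?_))
      refine Finset.card_bij (fun f _ => (a - n + ((f.1 : ℕ) : ℤ), b - n + ((f.2 : ℕ) : ℤ))) ?_ ?_ ?_
      · intro f hf
        simp only [Finset.mem_filter, Finset.mem_univ, true_and] at hf
        obtain ⟨hf1, hf2, hf3⟩ := hf
        have := f.1.isLt
        have := f.2.isLt
        simp only [Finset.mem_filter, Finset.mem_inter, spanRect, intF, Finset.mem_product, Finset.mem_Ico]
        refine ⟨by omega, ?_⟩
        simpa [Qarr] using hf3
      · intro f₁ _ f₂ _ hEq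
        simp only [Prod.mk.injEq] at hEq
        exact Prod.ext (Fin.ext (by omega)) (Fin.ext (by omega))
      · intro c hc
        simp only [Finset.mem_filter, Finset.mem_inter, spanRect, intF, Finset.mem_product, Finset.mem_Ico] at hc
        have hc' : (a - n + (((c.1 - (a - n)).toNat : ℕ) : ℤ), b - n + (((c.2 - (b - n)).toNat : ℕ) : ℤ)) = c :=
          Prod.ext (by simp only; omega) (by simp only; omega)
        refine ⟨(⟨(c.1 - (a - n)).toNat, by omega⟩, ⟨(c.2 - (b - n)).toNat, by omega⟩), ?_, hc'⟩
        simp only [Finset.mem_filter, Finset.mem_univ, true_and]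
        refine ⟨by omega, by omega, ?_⟩
        simp only [Qarr, decide_eq_true_eq]
        rw [hc']
        exact hc.2
    simp only [obs, boxObs, Set.mem_setOf_eq, mem_blackSet_screenShear]
    rw [exists_boxIndex_iff a b w h v ij hij, key]
  · -- flags: the coin of the box face `v`
    simp only [obs, boxObs, antiSet, screenShear, Set.mem_setOf_eq]
    rw [exists_boxIndex_iff a b w h v ij hij, Cbox, decide_eq_true_iff, ← hij]

/-- REGISTERED SUB-GOAL · `farObs` reads the environment only (off the box). [folklore] -/
theorem farObs_projEnv :
    ∀ (S : Set ℤ) (a b : ℤ) (w h n m k : ℕ) (ω : Ω) (kk : (Fin m → Bool) × (Fin k → Bool)) (v : Site 2),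
      v ∉ boxCells a b w h →
      ((v ∈ (farObs S (a - n) (a + w + n) (b - n) (b + h + n) m k (projEnv a b w h n ω) kk).1 ↔
        v ∈ (farObs S (a - n) (a + w + n) (b - n) (b + h + n) m k ω kk).1) ∧
       (v ∈ (farObs S (a - n) (a + w + n) (b - n) (b + h + n) m k (projEnv a b w h n ω) kk).2 ↔
        v ∈ (farObs S (a - n) (a + w + n) (b - n) (b + h + n) m k ω kk).2)) := by
  intro S a b w h n m k ω kk v hv
  constructor
  · simp only [farObs, Set.mem_setOf_eq, outPar_projEnv]
    exact Iff.rfl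
  · simp only [farObs, Set.mem_setOf_eq]
    show v 0 ∉ S ∨ v ∈ ω.2.2.2.2 ∩ (boxCells a b w h)ᶜ ↔ v 0 ∉ S ∨ v ∈ ω.2.2.2.2
    rw [Set.mem_inter_iff, Set.mem_compl_iff]
    exact or_congr_right (and_iff_left hv)

/-- REGISTERED SUB-GOAL · `boxObs` reads the environment only. [folklore] -/
theorem boxObs_projEnv :
    ∀ (S : Set ℤ) (a b : ℤ) (w h n : ℕ) (ω : Ω) (t cc : Fin w × Fin h → Bool),
      boxObs S (a - n) (a + w + n) (b - n) (b + h + n) a b w h (projEnv a b w h n ω) t cc =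
        boxObs S (a - n) (a + w + n) (b - n) (b + h + n) a b w h ω t cc := by
  intro S a b w h n ω t cc
  simp only [boxObs, outPar_projEnv]
  rfl

/-- REGISTERED SUB-GOAL · ADDITIVE OFFSETS: changing the environment changes the box colours by an additive
pattern `A i ⊕ B j`. [folklore] -/
theorem boxObs_offset :
    ∀ (S : Set ℤ) (a b : ℤ) (w h n : ℕ) (ω ω' : Ω), ∃ (A : Fin w → Bool) (B : Fin h → Bool),
      ∀ (t cc : Fin w × Fin h → Bool),
        boxObs S (a - n) (a + w + n) (b - n) (b + h + n) a b w h ω' t cc =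
          boxObs S (a - n) (a + w + n) (b - n) (b + h + n) a b w h ω
            (fun ij => xor (t ij) (xor (A ij.1) (B ij.2))) cc := by
  intro S a b w h n ω ω'
  refine ⟨fun i => decide (Xor (Xor (a + ((i : ℕ) : ℤ) ∈ ω.1) (a + ((i : ℕ) : ℤ) ∈ ω'.1)) (Xor
      (Xor (outPar S (a - n) (a + w + n) (b - n) (b + h + n) ω
          (Finset.Ico (a - n) (a + ((i : ℕ) : ℤ)) ×ˢ Finset.Ico (min 0 (b - n)) (max 0 (b - n))))
        (outPar S (a - n) (a + w + n) (b - n) (b + h + n) ω'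
          (Finset.Ico (a - n) (a + ((i : ℕ) : ℤ)) ×ˢ Finset.Ico (min 0 (b - n)) (max 0 (b - n)))))
      (Xor (outPar S (a - n) (a + w + n) (b - n) (b + h + n) ω (rect0 (a - n) (b - n)))
        (outPar S (a - n) (a + w + n) (b - n) (b + h + n) ω' (rect0 (a - n) (b - n)))))),
    fun j => decide (Xor (Xor (b + ((j : ℕ) : ℤ) ∈ ω.2.1) (b + ((j : ℕ) : ℤ) ∈ ω'.2.1)) (Xor
      (outPar S (a - n) (a + w + n) (b - n) (b + h + n) ω
        (Finset.Ico (min 0 (a - n)) (max 0 (a - n)) ×ˢ Finset.Ico (b - n) (b + ((j : ℕ) : ℤ))))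
      (outPar S (a - n) (a + w + n) (b - n) (b + h + n) ω'
        (Finset.Ico (min 0 (a - n)) (max 0 (a - n)) ×ˢ Finset.Ico (b - n) (b + ((j : ℕ) : ℤ)))))),
    fun t cc => Prod.ext (Set.ext fun v => ?_) rfl⟩
  simp only [boxObs, Set.mem_setOf_eq]
  refine exists_congr fun ij => and_congr_right fun hv => ?_
  have h0 : v 0 = a + ((ij.1 : ℕ) : ℤ) := by rw [hv]; simp
  have h1 : v 1 = b + ((ij.2 : ℕ) : ℤ) := by rw [hv]; simp
  have hi := ij.1.isLt
  have hj := ij.2.isLt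
  rw [outPar_rect0_near S (a - n) (a + w + n) (b - n) (b + h + n) ω v (by omega) (by omega) (by omega) (by omega),
    outPar_rect0_near S (a - n) (a + w + n) (b - n) (b + h + n) ω' v (by omega) (by omega) (by omega) (by omega),
    xor_decide_decide_iff, h0, h1]
  exact xor_offset_aux _ _ _ _ _ _ _ _ _ _ _

end Summit.CriticalPhenomena.CardyFormulaZ2.Theorems.IKLinearTransport.PinnedDiagramExchange.ScreeningAssembly
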